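import Summits.HodgeConjecture.HodgeConjecture.Theorems.VHCAbelianSchemesRoadSecondCarriedHGoodTypingDefs
import HarnessLib

/-!
# Road №4 (`VHCAbelianSchemesRoad`) — (F0-a) AN OBJECT-LEVEL HANDLE ON PRINT'S SHEAF `𝓔̄` WITH THE MOVER-FAMILY PROPERTY:
# the interface `SecantQuotientDatum.PrintSheafHandle` and the construction node `PrintSheafHandleExists`
# — the displayed input of child (c4) `stub_offDiagonalExtVanishing_someMover_63_OffHypDisjTwPrime` of crux stmt-HodgeConjecture-26512
# (skeleton v3.10 ecf7d13a82dcd12e)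

research route conditional on HC_CM; not a corollary; Q11.4-sentence-2 already refuted in dim ≥ 3.

DEFINITIONS + two unfolding lemmas (ring2 LEAD 163 = planner-pub-hodge-ring2-typer1-g161-0, typist by director-hodge g14 R14.33 (1);
ruling (α) GO (F0-a) on the LEAD's k0 of R14.25 (2); `HC_CM` nowhere; NOTHING asserted — in particular the construction node below is an
in-house conjecture, displayed wherever used, never a Literature fact).

WHY THIS NODE EXISTS (ring2-b03x g14 `THEOREM-C3-b03x-g14.md` §4, F0–F7). Child (c4) of the crux asks, at every secant quotient `Y = X/G₂`
presented by a NON-hyperelliptic H-good genus-3 datum `D` (H = `OrbitTranslatesDisjoint`, print's §9.1 standing hypothesis) with pin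
`h_Y(θ₀)`, for SOME pinned-served class `γ₀`, SOME `AdmTw′`-carrier `𝓓₀` pinned to it and SOME mover `ḡ_{u_m}` (`u_m = m + φ_d`,
`SecantQuotientDatum.IsMover m g`; the movers EXIST, `SecantQuotientDatum.hasMover`, p621769) off the three degenerate directions, with
OFF-DIAGONAL EXT VANISHING `OffDiagonalExtVanishing D.Y g 𝓓₀.E` (the (C^∨) hypothesis of THEOREM T). The only argument on the table
(refute-markman W9 §1, in-house ×2 at §4.4-generic data) is FOR PRINT'S SHEAF `𝓔̄` — Markman's reflexive secant sheaf, descended from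
`I_{C̄}(N̄) ⊠ …` on `X × X̂` (arXiv:2502.03415 §4.1) — and the mover FAMILY `u_m`: (F2) the piece decomposition
`Ext^k(g_*F, g_*F) ≅ ⊕_{x ∈ Ker g} Ext^k(τ_x^*F, F)` + Künneth (= the cores (R) `IsogenyPushforwardExtRankTransfer` ∕ (D)
`IsogenyPullbackPushforwardDecomposition` of the cell, the latter PROVED p642704), (F3) the factor-2 table
`Ext^•(I_{C̄}(N̄), I_{C̄}(N̄) ⊗ P_c) = (0, k, k, 0)`, `k = h⁰(N_{C̄} ⊗ η)`, and the base-point-free-pencil trick «`k = 0 ⟺ η ∉ (C − C) ∪ {0}`»,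
(F4) RAYNAUD 1983 (Manin–Mumford for subvarieties; tree fact `Literature.AlgebraicGeometry.Motives.Raynaud1983_maninMumford`, BY NAME) + the
genus-3 geometry ⟹ `(C − C) ∩ J_tors` FINITE, so the set of BAD torsion orders is finite, (F5) CRT: infinitely many `m` with `m² + d` prime to
a finite set of orders `> 1`, (F6) `hasMover`, (F7) parity. But the crux's print input `hL` (item 26511 `MarkmanPinnedForallTwPrime` =
`Markman2025_secantQuotient_twistedCarrier_onJacobian_pinnedForall C AdmTw′` for all `C`) is an `∃`-statement over `twistedReflexiveClass`: it
yields SOME admissible bounded complex with print's CLASSES (`PinnedTwistedDatum.nonempty_of_pinnedForall`), never print's SHEAF; and 26511 is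
GENERIC-ONLY (director-hodge g12 R12.6 (α) ∕ refute-markman WAKE #8): its text is print's claim under H verbatim and may not be strengthened to
carry (C^∨_{u_m}), which print nowhere states. Hence (F0-a): an INTERFACE carrying print's sheaf as an OBJECT together with the finite bad
set and the mover-family property — NO existence asserted in the interface — and a separate CONSTRUCTION node asserting that the handle
exists at every non-hyperelliptic H-good datum (the two hypotheses in 26511's position), IN-HOUSE and BEYOND PRINT, displayed wherever used,
refuter target at the W9 RESULT B datum (an `Aut`-symmetric H-good CM genus-3 datum). The rejected alternative (F0-b) «L1‴ = L1″_∀ ∧ (C^∨_{u_m})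
on the witnessing object» is, over the datum, LITERALLY EQUIVALENT to the construction node (`printSheafHandleExists_iff` below, by flattening
the structure) and forbidden as a Markman-cited claim-fact (R14.33).

CONSUMER (exactly one): (c4) ⟸ `PrintSheafHandleExists C` by the kernel lemma `offDiagonalExtVanishing_someMover_of_printSheafHandleExists`
(content F5 + F7 + F6; ring2-b03x g15 plate item (0), a separate proofs-only file importing this one). No other stub of the skeleton
consumes the handle; `hL`, 26511, `closes` and route rev 27 are untouched.

NOT CLAIMED: `PrintSheafHandleExists C` for any `C`, (C^∨) for any object, (c4), any stub, the crux, 26511, 23176, `HC_AV`, `HC_CM` or HC;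
HC_CM HELD, by name only; typed ≠ proved; a displayed input is not progress.
References: [cite: Markman2025SecantWeil, §4.1 (the secant sheaf), §9.1 (Assumption 9.1.1, Lemma 9.1.4) and Thm. 1.4.1]
[cite: Raynaud1983SousVarietes, Théorème principal] [cite: MumfordAV1970, §7 Thm. 4 (p. 72)].
-/

noncomputable section

open CategoryTheory CategoryTheory.Limits AlgebraicGeometry Topology

namespace Summit.HodgeConjecture.HodgeConjecture.Ring2.SemiregularRepresentatives

set_option linter.dupNamespace false -- the cell's namespace repeats the summit name, as in every `Ring2*` file

open Literature.AlgebraicGeometry Literature.AlgebraicGeometry.Motives Literature.AlgebraicGeometry.Motives.AbelianVariety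
open Literature.AlgebraicGeometry.HodgeTheory Literature.AlgebraicGeometry.Markman2025
open Literature.AlgebraicTopology.SingularHomology

/-- **(F0-a) SIG 1 — THE INTERFACE: an object-level handle on print's sheaf `𝓔̄` at the datum `(D, θ₀)`, with the mover-family property
(C^∨_{u_m}) off a finite set of bad torsion orders.** Fields: print's class `γ̄` on `Y = X/G₂` (`γ`), its membership in the pinned served set
at `(D.Y.X, h_Y(θ₀))` (`served`), print's sheaf as an `AdmTw′`-twisted datum pinned to `(h_Y(θ₀), γ̄)` — a bounded locally free resolution `E•`
of `𝓔̄` with its `B`-field and Chern data (`datum`), the FINITE set of bad torsion orders (`bad`; on paper `T(C) ∪ {d+1}`, `T(C)` = the orders of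
the torsion points on the difference surface `C − C ⊂ J`, finite by Raynaud + genus-3 geometry), none of them trivial (`one_lt_of_mem_bad`), and
the mover-FAMILY property (`offDiag`): every mover `ḡ_{u_m}` of `Y` (`D.IsMover m g`, `u_m = m + φ_d`) whose norm `m² + d` is prime to every
bad order acts on `E•` with off-diagonal Ext vanishing. NO EXISTENCE IS ASSERTED HERE: this is data + axioms, inhabited only by a construction. -/
structure SecantQuotientDatum.PrintSheafHandle (C : ChernCharacterBetti) (D : SecantQuotientDatum)
    (θ₀ : complexBetti D.𝒥.J.X 2) where
  /-- print's class `γ̄` on the secant quotient `Y = X/G₂`, in degree `6 = 2·3`. -/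
  γ : complexBetti D.Y.X (2 * 3)
  /-- `γ̄` is pinned-served at `(D.Y.X, h_Y(θ₀))`. -/
  served : γ ∈ secantQuotientServedClassesPinned D.Y.X (D.hY θ₀)
  /-- print's sheaf: a bounded locally free resolution `E•` of `𝓔̄` with its `B`-field, as an `AdmTw′`-twisted datum pinned to `(h_Y(θ₀), γ̄)`. -/
  datum : PinnedTwistedDatum C
    (fun n X₀ I E => Summit.Ventures.HSemireg.gluableSigmaAdmissible n X₀ I E ∨ bfSingleAdmissible' n X₀ I E)
    D.Y.X (D.hY θ₀) γ
  /-- the finite set of BAD torsion orders (on paper `T(C) ∪ {d+1}`; finiteness is where Raynaud 1983 enters the construction). -/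
  bad : Finset ℕ
  /-- no bad order is trivial (so that CRT can dodge them all at once). -/
  one_lt_of_mem_bad : ∀ N ∈ bad, 1 < N
  /-- (C^∨_{u_m}) OFF THE BAD SET: every mover `ḡ_{u_m}` (`u_m = m + φ_d`) with `m² + d` prime to the bad orders acts on `E•` with
  off-diagonal Ext vanishing `Ext^•(τ_x^* E•, E•) = 0`, `x ∈ Ker ḡ_{u_m}(ℂ) ∖ 0` (W9 §1 (a)–(c): piece decomposition, factor-2 table, bpf-pencil trick). -/
  offDiag : ∀ (m : ℤ) (g : D.Y ⟶ D.Y), D.IsMover m g → (∀ N ∈ bad, ¬ ((N : ℤ) ∣ m ^ 2 + (D.d : ℤ))) →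
    OffDiagonalExtVanishing D.Y g datum.E

/-- **(F0-a) SIG 2 — THE CONSTRUCTION NODE `PrintSheafHandleExists C` (IN-HOUSE, BEYOND PRINT; displayed wherever used; refuter target):** at every
secant-quotient datum `D` presented by a NON-hyperelliptic curve with H = `OrbitTranslatesDisjoint D.𝒥 D.G₁ D.G₂` (the two hypotheses in item
26511's position — GENERIC-ONLY, director-hodge g12 R12.6 (α)) and every polarisation class `θ₀` of `Θ`, print's sheaf handle EXISTS for the
Chern-character package `C` at `AdmTw′`. Paper argument: refute-markman W9 §1 (F2 Künneth pieces = cores (R)∕(D); F3 factor-2 tables; F4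
`Raynaud1983_maninMumford` BY NAME + the genus-3 corollary «`(C − C) ∩ J_tors` finite»), on top of print's construction of `𝓔̄` and its
`AdmTw′`-admissibility (L1″, THEOREM T ×2 with O₁ at §4.4-generic data). WHY IT MIGHT FAIL: at special non-hyperelliptic H-good data (CM ∕
`Aut`-symmetric Jacobians, W9 RESULT B: the FIXED mover `u₂` is dead there) EVERY `u_m` might meet a torsion difference on `C − C` of order dividing
`m² + d` — only if `C − C` contained a torsion translate of a positive-dimensional abelian subvariety, which the genus-3 geometry excludes on paper;
or print's `𝓔̄` might fail `AdmTw′`-admissibility off the §4.4-generic set (O₁). Consumed by (c4) ALONE, through the CRT lemma. -/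
@[conjecture] def PrintSheafHandleExists (C : ChernCharacterBetti) : Prop :=
  ∀ (D : SecantQuotientDatum) (θ₀ : complexBetti D.𝒥.J.X 2),
    ¬ D.𝒥.IsHyperelliptic → OrbitTranslatesDisjoint D.𝒥 D.G₁ D.G₂ → D.𝒥.J.IsPolarizationClassOf D.Θ θ₀ →
    Nonempty (D.PrintSheafHandle C θ₀)

/-- A handle exhibits a pinned-served class carrying a pinned `AdmTw′`-twisted datum at the datum's own chart (the non-vacuity input of (c4)). -/
theorem SecantQuotientDatum.PrintSheafHandle.exists_served_nonempty_pinnedTwistedDatum {C : ChernCharacterBetti} {D : SecantQuotientDatum}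
    {θ₀ : complexBetti D.𝒥.J.X 2} (H : D.PrintSheafHandle C θ₀) :
    ∃ γ ∈ secantQuotientServedClassesPinned D.Y.X (D.hY θ₀),
      Nonempty (PinnedTwistedDatum C
        (fun n X₀ I E => Summit.Ventures.HSemireg.gluableSigmaAdmissible n X₀ I E ∨ bfSingleAdmissible' n X₀ I E)
        D.Y.X (D.hY θ₀) γ) :=
  ⟨H.γ, H.served, ⟨H.datum⟩⟩

/-- **The construction node in flattened `∃`-form** (= the rejected (F0-b) phrasing «L1″_∀ ∧ (C^∨_{u_m}) on the witnessing object» read over the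
datum): the two carry the same information. This is the form a refuter attacks at one datum. -/
theorem printSheafHandleExists_iff (C : ChernCharacterBetti) :
    PrintSheafHandleExists C ↔
      ∀ (D : SecantQuotientDatum) (θ₀ : complexBetti D.𝒥.J.X 2),
        ¬ D.𝒥.IsHyperelliptic → OrbitTranslatesDisjoint D.𝒥 D.G₁ D.G₂ → D.𝒥.J.IsPolarizationClassOf D.Θ θ₀ →
        ∃ γ ∈ secantQuotientServedClassesPinned D.Y.X (D.hY θ₀),
          ∃ (𝓓 : PinnedTwistedDatum C
              (fun n X₀ I E => Summit.Ventures.HSemireg.gluableSigmaAdmissible n X₀ I E ∨ bfSingleAdmissible' n X₀ I E)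
              D.Y.X (D.hY θ₀) γ) (T : Finset ℕ),
            (∀ N ∈ T, 1 < N) ∧
            ∀ (m : ℤ) (g : D.Y ⟶ D.Y), D.IsMover m g → (∀ N ∈ T, ¬ ((N : ℤ) ∣ m ^ 2 + (D.d : ℤ))) →
              OffDiagonalExtVanishing D.Y g 𝓓.E := by
  constructor
  · intro h D θ₀ hnh hH hθ₀
    obtain ⟨H⟩ := h D θ₀ hnh hH hθ₀
    exact ⟨H.γ, H.served, H.datum, H.bad, H.one_lt_of_mem_bad, H.offDiag⟩
  · intro h D θ₀ hnh hH hθ₀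
    obtain ⟨γ, hγ, 𝓓, T, hT, hoff⟩ := h D θ₀ hnh hH hθ₀
    exact ⟨⟨γ, hγ, 𝓓, T, hT, hoff⟩⟩

end Summit.HodgeConjecture.HodgeConjecture.Ring2.SemiregularRepresentatives

end
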